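import Literature.AlgebraicGeometry.Motives.HodgeStructureCentralizerHomIsomorphismTransport
import HarnessLib

/-!
# MILNE'S PROP. 1.1 «OF `k`-ALGEBRAS WITH INVOLUTION» OVER THE REPRESENTATIVES: the isomorphisms `C(⊕ᵢ Tᵢ ≅ H₀) ≃ₐ C(H₀)`,
# `C(W_k) ≃ₐ C(T_k)`, `C(H) ≃ₐ Π_k C(T_k)` and `C(S) ≃ₐ C(U)` of g52-#5 can be chosen compatible with the adjoint involutions
# `†` of ANY polarizations — `(C(H), †_ψ) ≃ₐ Π_k (C(T_k), †_{ψ|T_k})` (Milne 1999 §1 Prop. 1.1)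

[topic AlgebraicGeometry/Motives]

Layer `Literature/AlgebraicGeometry/Motives`, lane `lit-hodgefound` (Track 2 foundations library; prover seat
`lit-hodgefound-p02`, generation 52, self-proposed row g52-#11). THEOREMS ONLY: no definition, no named fact (net debt `0`),
no instance, no notation.  g52-#3 gave `(C(H), †) ≃ₐ Π_k (C(W_k), †_k)` along Hom-orthogonal internal blocks
(`Polarization.exists_algEquiv_pi_centralizer_adjoint_of_hom_orthogonal`) and g52-#5 the block isomorphisms `C(W_k) ≃ₐ C(T_k)`
WITHOUT the involution; g52-#8 gave transport along a Hodge isomorphism WITH the involution for any polarizations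
(`Polarization.exists_centralizer_endAlg_algEquiv_adjoint_of_hom_bijective`).  Here the two are combined with p34's diagonal
`centralizerPiConstAlgEquiv : C(H₀) ≃ₐ C(H₀^{⊕ι})` and `Polarization.adjoint_pi_piDiag` («the involution it defines on `C(A)` is the
restriction of the product of the involutions», `Motives/HodgeStructureLefschetzGroupFiniteDirectSum`): since `†` on `C` does not
depend on the polarization (Milne p. 643 L5–L6), the non-isometric Hodge isomorphism `T_k^{⊕m} ⥲ W_k` still respects `†`.

## The source, verbatim

J. S. Milne, *Lefschetz classes on abelian varieties*, Duke Math. J. 96 (1999) 639–675 [Milne1999LefschetzClasses] (held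
`paper:doi-10-1215-s0012-7094-99-09620-5`), §1 p. 643 L5–L14: "Then `C(A)` is a `k`-algebra stable under the involution `†`
defined by an ample divisor `D`, and the restriction of `†` to `C(A)` is independent of the choice of `D`. An isogeny `α : A → B`
defines an isomorphism `γ ↦ V(α) ∘ γ ∘ V(α)⁻¹ : C(A) → C(B)` of `k`-algebras with involution […]. For any positive integer `r`,
`V(A^r) = rV(A)`, and the diagonal action of `C(A)` on `rV(A)` identifies `C(A)` with `C(A^r)` (as `k`-algebras with involution).";
L24–L28: "**Proposition 1.1.** […] Any such isogeny induces an isomorphism `C(A₁) × ⋯ × C(A_s) → C(A)` of `k`-algebras with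
involution, which is independent of the choice of the isogeny."  Also D. Huybrechts [Huybrechts2016K3] Ch. 3 §3.3.5 eq. (3.3).

## Dictionary and what is proved (namespace `Literature.AlgebraicGeometry.Motives.HodgeStructure`)

`C(H) = Subalgebra.centralizer ℚ E_φ(H)`, `c^† = Q.adjoint c` (`†` preserves `C(H)`: p34's `Polarization.adjoint_mem_centralizer_endAlg`);
"`E` carries `†₁` to `†₂`" = `∀ c, E (c^{†₁}) = (E c)^{†₂}` on underlying endomorphisms.

* §1 **`Polarization.exists_centralizer_endAlg_algEquiv_adjoint_of_isInternal_of_forall_bijective`** («identifies `C(A)` with `C(A^r)`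
  (as `k`-algebras with involution)», internally: `(C(H₀), †_{ψ₀}) ≃ₐ (C(H'), †_{ψ'})` for `V' = ⊕ᵢ Tᵢ`, `Tᵢ ≅ H₀`, ANY `ψ₀`, `ψ'`).
* §2 `Polarization.exists_centralizer_endAlg_iSup'_fiber_algEquiv_adjoint` (`(C(W_k), †) ≃ₐ (C(T_k), †)` per isotypic block),
  **`Polarization.exists_algEquiv_pi_centralizer_adjoint_of_labelling`** (PROP. 1.1 WITH INVOLUTION over the representatives:
  `(C(H), †_ψ) ≃ₐ Π_k (C(T_k), †_{ψ|T_k})`).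
* §3 **`Polarization.exists_centralizer_endAlg_algEquiv_adjoint_of_minimal_stable`** (`(C(S), †) ≃ₐ (C(U), †)` for a canonical
  block `S ⊇ U` irreducible).
-/

noncomputable section

namespace Literature.AlgebraicGeometry.Motives

namespace HodgeStructure

universe u

variable {n : ℤ}

/-- Re-indexing an internal direct sum along an equivalence of index types. [folklore] -/
private theorem isInternal_comp_equiv'''' {V' : Type u} [AddCommGroup V'] [Module ℚ V'] {ι ι' : Type*} [DecidableEq ι]
    [DecidableEq ι'] {A : ι → Submodule ℚ V'} (hA : DirectSum.IsInternal A) (e : ι' ≃ ι) :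
    DirectSum.IsInternal fun j => A (e j) := by
  refine (DirectSum.isInternal_submodule_iff_iSupIndep_and_iSup_eq_top _).2 ⟨?_, ?_⟩
  · exact hA.submodule_iSupIndep.comp e.injective
  · rw [e.iSup_comp (g := A)]
    exact hA.submodule_iSup_eq_top

/-! ## §1 «identifies `C(A)` with `C(A^r)` (as `k`-algebras with involution)», internally -/

section IsotypicInternal

variable {V' : Type u} [AddCommGroup V'] [Module ℚ V'] [Module.Finite ℚ V'] {H' : HodgeStructure V' n}
  {W₀ : Type u} [AddCommGroup W₀] [Module ℚ W₀] [Module.Finite ℚ W₀] {H₀ : HodgeStructure W₀ n}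
  {ι : Type} [Fintype ι] [DecidableEq ι] (T : ι → SubHodgeStructure H')
  (hT : DirectSum.IsInternal fun i => (T i).toSubmodule)
  (r : ∀ i, Hom H₀ (T i).toHodgeStructure) (hr : ∀ i, Function.Bijective (r i).toLinearMap)

include hT hr

/-- **«the diagonal action of `C(A)` on `rV(A)` identifies `C(A)` with `C(A^r)` (as `k`-algebras with involution)», INTERNALLY and
for ANY polarizations**: for an internal direct sum `V' = ⊕ᵢ Tᵢ` (`ι ≠ ∅`) of sub-Hodge structures all isomorphic to `H₀` and
polarizations `ψ₀` of `H₀`, `ψ'` of `H'`, there is `E : C(H₀) ≃ₐ[ℚ] C(H')` with `E (c^{†₀}) = (E c)^{†'}` — the diagonal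
`C(H₀) ≃ₐ C(H₀^{⊕ι})` carries `†₀` to the adjoint of the product polarization (`adjoint_pi_piDiag`), and the transport along the
Hodge isomorphism `H₀^{⊕ι} ⥲ H'` carries the latter to `†'` (g52-#8, `†` on `C` being independent of the polarization).
[cite: Milne1999LefschetzClasses, §1 p. 643 L5–L14] [cite: Huybrechts2016K3, Ch. 3 §3.3.5 eq. (3.3)] -/
theorem Polarization.exists_centralizer_endAlg_algEquiv_adjoint_of_isInternal_of_forall_bijective [Nonempty ι]
    (ψ₀ : Polarization H₀) (ψ' : Polarization H') :
    ∃ E : Subalgebra.centralizer ℚ (H₀.endAlg : Set (Module.End ℚ W₀)) ≃ₐ[ℚ]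
        Subalgebra.centralizer ℚ (H'.endAlg : Set (Module.End ℚ V')),
      ∀ c : Subalgebra.centralizer ℚ (H₀.endAlg : Set (Module.End ℚ W₀)),
        ((E ⟨ψ₀.adjoint c, ψ₀.adjoint_mem_centralizer_endAlg c.2⟩ :
            Subalgebra.centralizer ℚ (H'.endAlg : Set (Module.End ℚ V'))) : Module.End ℚ V') =
          ψ'.adjoint ((E c : Subalgebra.centralizer ℚ (H'.endAlg : Set (Module.End ℚ V'))) : Module.End ℚ V') := by
  -- transport along `Φ : H₀^{⊕ι} ⥲ H'` with the involutions of `Π ψ₀` and `ψ'`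
  obtain ⟨e₁, -, he₁⟩ := Polarization.exists_centralizer_endAlg_algEquiv_adjoint_of_hom_bijective _
    (bijective_piDesc_subtypeHom_comp_toLinearMap T hT r hr) (Polarization.pi fun _ : ι => ψ₀) ψ'
  -- the diagonal `d : C(H₀) ≃ₐ C(H₀^{⊕ι})` carries `†₀` to `†_{Π ψ₀}`
  let d := centralizerPiConstAlgEquiv (ι := ι) H₀
  have hd : ∀ c : Subalgebra.centralizer ℚ (H₀.endAlg : Set (Module.End ℚ W₀)),
      d ⟨ψ₀.adjoint c, ψ₀.adjoint_mem_centralizer_endAlg c.2⟩ =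
        ⟨(Polarization.pi fun _ : ι => ψ₀).adjoint (d c : Module.End ℚ (ι → W₀)),
          (Polarization.pi fun _ : ι => ψ₀).adjoint_mem_centralizer_endAlg (d c).2⟩ := fun c => by
    refine Subtype.ext ?_
    change (d ⟨ψ₀.adjoint c, ψ₀.adjoint_mem_centralizer_endAlg c.2⟩ : Module.End ℚ (ι → W₀)) =
      (Polarization.pi fun _ : ι => ψ₀).adjoint (d c : Module.End ℚ (ι → W₀))
    rw [coe_centralizerPiConstAlgEquiv_apply, coe_centralizerPiConstAlgEquiv_apply, Polarization.adjoint_pi_piDiag]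
  refine ⟨d.trans e₁, fun c => ?_⟩
  rw [AlgEquiv.trans_apply, AlgEquiv.trans_apply, hd c]
  exact he₁ (d c)

end IsotypicInternal

/-! ## §2 Prop. 1.1 with involution over the representatives of a labelled irreducible decomposition -/

section Labelled

variable {V : Type u} [AddCommGroup V] [Module ℚ V] [Module.Finite ℚ V] {H : HodgeStructure V n}
  {ι : Type*} [Fintype ι] [DecidableEq ι] (T : ι → SubHodgeStructure H)
  (hT : DirectSum.IsInternal fun i => (T i).toSubmodule) {κ : Finset ι} {c : ι → κ}
  (hc : ∀ i, ∃ g : Hom (T i).toHodgeStructure (T (c i)).toHodgeStructure, Function.Bijective g.toLinearMap)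
  (hκ : ∀ k k' : κ, (∃ g : Hom (T k).toHodgeStructure (T k').toHodgeStructure,
    Function.Bijective g.toLinearMap) → k = k')

include hT hc hκ

/-- **`(C(W_k), †_{ψ|W_k}) ≃ₐ (C(T_k), †_{ψ|T_k})` for every isotypic block `W_k = ⨆_{c i = k} Tᵢ`** of a labelled irreducible
decomposition of a polarized `(H, ψ)` (§1 inverted, after re-indexing by `Fin m`). [cite: Milne1999LefschetzClasses, §1 p. 643 L5–L14 and Prop. 1.1] -/
theorem Polarization.exists_centralizer_endAlg_iSup'_fiber_algEquiv_adjoint (ψ : Polarization H) (k : κ) :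
    ∃ E : Subalgebra.centralizer ℚ
        ((SubHodgeStructure.iSup' fun x : {i // c i = k} => T x.1).toHodgeStructure.endAlg :
          Set (Module.End ℚ (SubHodgeStructure.iSup' fun x : {i // c i = k} => T x.1).toSubmodule)) ≃ₐ[ℚ]
        Subalgebra.centralizer ℚ ((T k).toHodgeStructure.endAlg : Set (Module.End ℚ (T k).toSubmodule)),
      ∀ x : Subalgebra.centralizer ℚ
        ((SubHodgeStructure.iSup' fun x : {i // c i = k} => T x.1).toHodgeStructure.endAlg :
          Set (Module.End ℚ (SubHodgeStructure.iSup' fun x : {i // c i = k} => T x.1).toSubmodule)),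
        ((E ⟨(ψ.restrict (SubHodgeStructure.iSup' fun x : {i // c i = k} => T x.1)).adjoint x,
            (ψ.restrict (SubHodgeStructure.iSup' fun x : {i // c i = k} => T x.1)).adjoint_mem_centralizer_endAlg x.2⟩ :
            Subalgebra.centralizer ℚ ((T k).toHodgeStructure.endAlg : Set (Module.End ℚ (T k).toSubmodule))) :
              Module.End ℚ (T k).toSubmodule) =
          (ψ.restrict (T k)).adjoint ((E x : Subalgebra.centralizer ℚ
            ((T k).toHodgeStructure.endAlg : Set (Module.End ℚ (T k).toSubmodule))) : Module.End ℚ (T k).toSubmodule) := by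
  classical
  choose r hr using exists_hom_comapSubtype_bijective T hc k
  let eι := (Fintype.equivFin {i // c i = k}).symm
  haveI : Nonempty (Fin (Fintype.card {i // c i = k})) := ⟨Fintype.equivFin _ ⟨k, apply_coe_eq T hc hκ k⟩⟩
  obtain ⟨E, hE⟩ := Polarization.exists_centralizer_endAlg_algEquiv_adjoint_of_isInternal_of_forall_bijective
    (fun j => (SubHodgeStructure.iSup' fun x : {i // c i = k} => T x.1).comapSubtype (T (eι j).1))
    (isInternal_comp_equiv'''' (isInternal_comapSubtype_iSup'_fiber T hT c k) eι)
    (fun j => r (eι j)) (fun j => hr (eι j)) (ψ.restrict (T k))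
    (ψ.restrict (SubHodgeStructure.iSup' fun x : {i // c i = k} => T x.1))
  -- invert `E : (C(T_k), †) ≃ₐ (C(W_k), †)`
  refine ⟨E.symm, fun x => ?_⟩
  have h := hE (E.symm x)
  rw [AlgEquiv.apply_symm_apply] at h
  have h' : E ⟨(ψ.restrict (T k)).adjoint (E.symm x : Module.End ℚ (T k).toSubmodule),
      (ψ.restrict (T k)).adjoint_mem_centralizer_endAlg (E.symm x).2⟩ =
        ⟨(ψ.restrict (SubHodgeStructure.iSup' fun x : {i // c i = k} => T x.1)).adjoint x,
          (ψ.restrict (SubHodgeStructure.iSup' fun x : {i // c i = k} => T x.1)).adjoint_mem_centralizer_endAlg x.2⟩ :=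
    Subtype.ext h
  rw [← h', AlgEquiv.symm_apply_apply]

/-- **MILNE'S PROPOSITION 1.1 «OF `k`-ALGEBRAS WITH INVOLUTION» over the representatives: `(C(H), †_ψ) ≃ₐ[ℚ] Π_k (C(T_k), †_{ψ|T_k})`**
for ANY isotypically-labelled irreducible decomposition of a polarized finite-dimensional `ℚ`-Hodge structure — an isomorphism
`e : C(H) ≃ₐ Π_k C(T_k)` with `e (c^†) = ((e c)_k^{†_k})_k` (g52-#3 on the Hom-orthogonal isotypic blocks, then §2 block by block).
[cite: Milne1999LefschetzClasses, §1 Prop. 1.1 (p. 643)] [cite: Huybrechts2016K3, Ch. 3 §3.3.5 eq. (3.3)] -/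
theorem Polarization.exists_algEquiv_pi_centralizer_adjoint_of_labelling (ψ : Polarization H)
    (hirr : ∀ i, (T i).toHodgeStructure.IsIrreducible) :
    ∃ e : Subalgebra.centralizer ℚ (H.endAlg : Set (Module.End ℚ V)) ≃ₐ[ℚ]
        Π k : κ, Subalgebra.centralizer ℚ ((T k).toHodgeStructure.endAlg : Set (Module.End ℚ (T k).toSubmodule)),
      ∀ (d : Subalgebra.centralizer ℚ (H.endAlg : Set (Module.End ℚ V))) (k : κ),
        ((e ⟨ψ.adjoint d, ψ.adjoint_mem_centralizer_endAlg d.2⟩ k) : Module.End ℚ (T k).toSubmodule) =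
          (ψ.restrict (T k)).adjoint (e d k) := by
  classical
  obtain ⟨eb, -, heb⟩ := ψ.exists_algEquiv_pi_centralizer_adjoint_of_hom_orthogonal
    (fun k : κ => SubHodgeStructure.iSup' fun x : {i // c i = k} => T x.1) (isInternal_iSup'_fiber T hT c)
    fun k l hkl f => hom_iSup'_fiber_eq_zero T hT hc hκ hirr hkl f
  choose E hE using fun k => ψ.exists_centralizer_endAlg_iSup'_fiber_algEquiv_adjoint T hT hc hκ k
  refine ⟨eb.trans (AlgEquiv.piCongrRight E), fun d k => ?_⟩
  have hk : eb ⟨ψ.adjoint d, ψ.adjoint_mem_centralizer_endAlg d.2⟩ k =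
      ⟨(ψ.restrict (SubHodgeStructure.iSup' fun x : {i // c i = k} => T x.1)).adjoint (eb d k),
        (ψ.restrict (SubHodgeStructure.iSup' fun x : {i // c i = k} => T x.1)).adjoint_mem_centralizer_endAlg (eb d k).2⟩ :=
    Subtype.ext (heb d k)
  rw [AlgEquiv.trans_apply, AlgEquiv.trans_apply, AlgEquiv.piCongrRight_apply, AlgEquiv.piCongrRight_apply, hk]
  exact hE k (eb d k)

end Labelled

/-! ## §3 The canonical block with its involution: `(C(S), †_{ψ|S}) ≃ₐ (C(U), †_{ψ|U})` -/

section Canonical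

variable {V : Type u} [AddCommGroup V] [Module ℚ V] [Module.Finite ℚ V] {H : HodgeStructure V n}

set_option maxHeartbeats 400000 in
/-- **`(C(S), †_{ψ|S}) ≃ₐ[ℚ] (C(U), †_{ψ|U})` for a CANONICAL BLOCK**: for a polarized `(H, ψ)`, a minimal non-zero `E_φ`-stable
sub-Hodge structure `S` and an irreducible `U ⊆ S`, the isomorphism `C(S) ≃ₐ C(U)` of g52-#5 can be chosen to carry the adjoint of
`ψ|_S` to the adjoint of `ψ|_U` (§2 for the block `S = W_k ⊇ T_k`, then g52-#8's transport along `T_k ≅ U`).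
[cite: Milne1999LefschetzClasses, §1 p. 643 L5–L14 and Prop. 1.1] -/
theorem Polarization.exists_centralizer_endAlg_algEquiv_adjoint_of_minimal_stable (ψ : Polarization H) {S U : SubHodgeStructure H}
    (hS : (∀ a ∈ H.endAlg, ∀ v ∈ S.toSubmodule, a v ∈ S.toSubmodule) ∧ S.toSubmodule ≠ ⊥ ∧
      ∀ S' : SubHodgeStructure H, (∀ a ∈ H.endAlg, ∀ v ∈ S'.toSubmodule, a v ∈ S'.toSubmodule) →
        S'.toSubmodule ≤ S.toSubmodule → S'.toSubmodule = ⊥ ∨ S'.toSubmodule = S.toSubmodule)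
    (hU : U.toHodgeStructure.IsIrreducible) (hUS : U.toSubmodule ≤ S.toSubmodule) :
    ∃ E : Subalgebra.centralizer ℚ (S.toHodgeStructure.endAlg : Set (Module.End ℚ S.toSubmodule)) ≃ₐ[ℚ]
        Subalgebra.centralizer ℚ (U.toHodgeStructure.endAlg : Set (Module.End ℚ U.toSubmodule)),
      ∀ x : Subalgebra.centralizer ℚ (S.toHodgeStructure.endAlg : Set (Module.End ℚ S.toSubmodule)),
        ((E ⟨(ψ.restrict S).adjoint x, (ψ.restrict S).adjoint_mem_centralizer_endAlg x.2⟩ :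
            Subalgebra.centralizer ℚ (U.toHodgeStructure.endAlg : Set (Module.End ℚ U.toSubmodule))) :
              Module.End ℚ U.toSubmodule) =
          (ψ.restrict U).adjoint ((E x : Subalgebra.centralizer ℚ
            (U.toHodgeStructure.endAlg : Set (Module.End ℚ U.toSubmodule))) : Module.End ℚ U.toSubmodule) := by
  classical
  have hH : H.IsPolarizable := ⟨ψ⟩
  obtain ⟨s, _, κ, c, hint, hirr, hc, hκ⟩ := exists_isInternal_isIrreducible_labelling H hH
  obtain ⟨k, hk, -⟩ := existsUnique_iSup'_fiber_eq_of_minimal_stable (fun x : s => (x : SubHodgeStructure H)) hint hc hκ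
    (fun x => hirr x x.2) hS
  subst hk
  obtain ⟨E₁, hE₁⟩ := ψ.exists_centralizer_endAlg_iSup'_fiber_algEquiv_adjoint (fun x : s => (x : SubHodgeStructure H))
    hint hc hκ k
  have hTk : ((k : s) : SubHodgeStructure H).toSubmodule ≤
      (SubHodgeStructure.iSup' fun x : {i : s // c i = k} => ((x.1 : s) : SubHodgeStructure H)).toSubmodule := by
    rw [SubHodgeStructure.iSup'_toSubmodule]
    exact le_iSup (fun x : {i : s // c i = k} => ((x.1 : s) : SubHodgeStructure H).toSubmodule)
      ⟨k, apply_coe_eq (fun x : s => (x : SubHodgeStructure H)) hc hκ k⟩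
  obtain ⟨g, hg⟩ := (exists_hom_bijective_iff_eq_of_minimal_stable hH hS hS (hirr (k : s) (k : s).2) hU hTk hUS).2 rfl
  obtain ⟨E₂, -, hE₂⟩ := Polarization.exists_centralizer_endAlg_algEquiv_adjoint_of_hom_bijective g hg
    (ψ.restrict (k : s)) (ψ.restrict U)
  refine ⟨E₁.trans E₂, fun x => ?_⟩
  have h1 : E₁ ⟨(ψ.restrict _).adjoint x, (ψ.restrict _).adjoint_mem_centralizer_endAlg x.2⟩ =
      ⟨(ψ.restrict (k : s)).adjoint (E₁ x), (ψ.restrict (k : s)).adjoint_mem_centralizer_endAlg (E₁ x).2⟩ :=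
    Subtype.ext (hE₁ x)
  rw [AlgEquiv.trans_apply, AlgEquiv.trans_apply, h1]
  exact hE₂ (E₁ x)

end Canonical

end HodgeStructure

end Literature.AlgebraicGeometry.Motives
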